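import Mathlib
import Summits.ValiantsHypothesis.ValiantsHypothesis.Theorems.RigidityForcesSymmetryRankRigidMinimalReprLaplaceFiveSeparatedCaptureLeadingMonomials

/-!
# ValiantsHypothesis / RigidityForcesSymmetry — crux `LaplaceOptimalFive` (stmt-ValiantsHypothesis-24813), symmetric capture:
# the AGREEMENT IDENTITIES and the SYMMETRISED FORM `T = Sp(A) − 2e − f` of a captured symmetric tensor (general spans)

Memo `pub/val-lit/lmr/NOTE-p4g17-24813-K32-symmetric-capture.md` §2a/§10 (L2) in the tree's tensor currency, for ARBITRARY symmetric
triangle spans `U₀₁, U₀₂, U₁₂`: if `T ∈ L₃(U₀₁,U₀₂,U₁₂)` has the finite form `T(p,q,r) = A_r(p,q) + B_q(p,r) + C_p(q,r)`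
(✓ `L3_finite_form`) and is symmetric under the slot transpositions `(0 1)`, `(1 2)`, then
* `agreement23` — `(A_r − B_r)(p,q) = (A_q − B_q)(p,r)`: the tuple `A − B` is FULLY SYMMETRIC (the tensor `e(p,q,r) := (A_r − B_r)(p,q)`
  is a symmetric 3-tensor whose `r`-slices lie in `A_r + U₀₂ ⊆ U₀₁ + U₀₂` — a PROLONGATION element);
* `agreement12` — `(B_q − C_q)(p,r) = (B_p − C_p)(q,r)`: likewise `f(p,q,r) := (B_q − C_q)(p,r)` is symmetric with slices in `U₀₂ + U₁₂`;
* ★ `capture_symmetrised_form` — `T = Sp(A) − 2e − f`, `Sp(A)(p,q,r) = A_r(p,q) + A_q(p,r) + A_p(q,r)` (✓ `Sp`).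
For EQUAL spans this is ✓ `equalSpans_symmetrise` (`e, f` absorbed); for `U₁₂ = ⊥` it is the `Ω = 0` split of ✓ `captureIneqSym_of_third_bot`;
for three lines it is the per-obligation structure of ✓ `lines_parallel_structure`.  Recorded as the common entry point of every profile analysis.

Honest framing.  Bookkeeping identities; close nothing; `CaptureIneqSym` general, K1 on `K₃ ⊔ K₂`, S2′, `LaplaceOptimalFive`
(OPEN · CONTESTED 72/120), `VP ≠ VNP` are NOT proved.  No definitions, no `sorry`.
-/

set_option linter.dupNamespace false
set_option autoImplicit false

namespace Summit.ValiantsHypothesis.ValiantsHypothesis.Theorems.RigidityForcesSymmetryRankRigidMinimalRepr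

namespace LaplaceFiveSeparatedCapture

open Finset

/-- AGREEMENT `(1 2)`: the slot symmetry `T(p,r,q) = T(p,q,r)` makes the tuple `A − B` fully symmetric. [folklore] -/
theorem agreement23 (A B C T : Fin 5 → Fin 5 → Fin 5 → ℂ) (hC : ∀ r p q, C r p q = C r q p)
    (hT : ∀ p q r, T p q r = A r p q + B q p r + C p q r) (h23 : ∀ p q r, T p r q = T p q r) (p q r : Fin 5) :
    A r p q - B r p q = A q p r - B q p r := by
  have h := h23 p q r
  rw [hT, hT, hC p r q] at h
  linear_combination -h

/-- AGREEMENT `(0 1)`: the slot symmetry `T(q,p,r) = T(p,q,r)` makes the tuple `B − C` fully symmetric. [folklore] -/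
theorem agreement12 (A B C T : Fin 5 → Fin 5 → Fin 5 → ℂ) (hA : ∀ r p q, A r p q = A r q p)
    (hT : ∀ p q r, T p q r = A r p q + B q p r + C p q r) (h12 : ∀ p q r, T q p r = T p q r) (p q r : Fin 5) :
    B q p r - C q p r = B p q r - C p q r := by
  have h := h12 p q r
  rw [hT, hT, hA r q p] at h
  linear_combination -h

/-- ★ SYMMETRISED FORM: with both slot symmetries, `T = Sp(A) − 2e − f` where `e(p,q,r) = (A_r − B_r)(p,q)` and
`f(p,q,r) = (B_q − C_q)(p,r)` are the (fully symmetric) agreement tensors. [folklore] -/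
theorem capture_symmetrised_form (A B C T : Fin 5 → Fin 5 → Fin 5 → ℂ)
    (hA : ∀ r p q, A r p q = A r q p) (hB : ∀ r p q, B r p q = B r q p) (hC : ∀ r p q, C r p q = C r q p)
    (hT : ∀ p q r, T p q r = A r p q + B q p r + C p q r)
    (h12 : ∀ p q r, T q p r = T p q r) (h23 : ∀ p q r, T p r q = T p q r) (p q r : Fin 5) :
    T p q r = (A r p q + A q p r + A p q r) - 2 * (A r p q - B r p q) - (B q p r - C q p r) := by
  have e1 := agreement23 A B C T hC hT h23 p q r
  have e2 := agreement23 A B C T hC hT h23 q p r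
  rw [hA r q p, hB r q p] at e2
  have f1 := agreement12 A B C T hA hT h12 p q r
  rw [hT]
  linear_combination e1 + e2 + f1

/-- The agreement tensor `e(p,q,r) := (A_r − B_r)(p,q)` is fully symmetric (both slot swaps). [folklore] -/
theorem agreementE_symm (A B C T : Fin 5 → Fin 5 → Fin 5 → ℂ)
    (hA : ∀ r p q, A r p q = A r q p) (hB : ∀ r p q, B r p q = B r q p) (hC : ∀ r p q, C r p q = C r q p)
    (hT : ∀ p q r, T p q r = A r p q + B q p r + C p q r) (h23 : ∀ p q r, T p r q = T p q r) (p q r : Fin 5) :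
    (A r q p - B r q p = A r p q - B r p q) ∧ (A q p r - B q p r = A r p q - B r p q) :=
  ⟨by rw [hA r q p, hB r q p], (agreement23 A B C T hC hT h23 p q r).symm⟩

/-- The agreement tensor `f(p,q,r) := (B_q − C_q)(p,r)` is fully symmetric (both slot swaps). [folklore] -/
theorem agreementF_symm (A B C T : Fin 5 → Fin 5 → Fin 5 → ℂ)
    (hA : ∀ r p q, A r p q = A r q p) (hB : ∀ r p q, B r p q = B r q p) (hC : ∀ r p q, C r p q = C r q p)
    (hT : ∀ p q r, T p q r = A r p q + B q p r + C p q r) (h12 : ∀ p q r, T q p r = T p q r) (p q r : Fin 5) :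
    (B q r p - C q r p = B q p r - C q p r) ∧ (B p q r - C p q r = B q p r - C q p r) :=
  ⟨by rw [hB q r p, hC q r p], (agreement12 A B C T hA hT h12 p q r).symm⟩

end LaplaceFiveSeparatedCapture

end Summit.ValiantsHypothesis.ValiantsHypothesis.Theorems.RigidityForcesSymmetryRankRigidMinimalRepr
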